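import Literature.NumberTheory.EllipticCurves.QuadraticTwist
import Literature.NumberTheory.EllipticCurves.VariableChangePointsMap
import Literature.NumberTheory.EllipticCurves.Sha
import Literature.NumberTheory.GaloisRepresentations.AbsGaloisGroup
import HarnessLib

/-!
# The twist isomorphism `E^{(d)} ≅ E` over ANY extension `L ∋ θ = √d`, functorially in `L`

Silverman, *AEC*, X.2 (proof of Prop. 2.4) and X.5 Cor. 5.4 (iii): over a field containing `θ = √d` the
substitution `u = θ` (`(x, y) ↦ (x/θ², y/θ³)`) identifies the quadratic twist `E^{(d)}` with the completed-square
model `E^{(1)} ≅ E`; under a field automorphism `σ` with `σθ = −θ` the identification changes sign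
(`E^{(d)}(\bar F) = E(\bar F) ⊗ χ_d` as Galois modules).

The tree has this substitution twice, each time tied to ONE coefficient field: `twistUntwist` /`twistIso`
(`QuadraticTwistRank`, `QuadraticTwistSelmerPInfty`: over a number field `K ∋ θ`, `θ ∉ ℚ`) and `untwist` /
`untwistEquiv` (`IsogenyQuadraticTwistProofs`: over `F̄` with `θ = geomSqrt d`, models with `a₁ = a₃ = 0`). For the
Selmer group over a `ℤ_p`-extension (`selmerGroupOver`, local conditions at the completions `K_v` through
`pointsMapOfEmb : E(K̄) → E(K̄_v)`) one needs the SAME substitution simultaneously over `K̄` and over every `K̄_v`,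
compatibly with the embeddings `K̄ → K̄_v` — i.e. functorially in the coefficient field. This file provides it:

* `sqrtChange hd hθ` — the change of variables `(θ, 0, 0, 0)` over any `F`-algebra field `L` with `θ² = d`;
  `sqrtChange_smul` — it carries `(W^{(d)})_L` to `(W^{(1)})_L` (the coefficient check of `untwist_smul` freed from
  `geomSqrt`); `sqrtChange_neg_smul` (`−θ` gives the same equation);
* `untwistOver W X hd hθ hX : (W^{(d)})_L(L) ≃+ X_L(L)` for any `X/F` with `sqrtChange • (W^{(d)})_L = X_L`
  (`X = W^{(1)}`, or `X = C • W` for the completed square `C • W = W^{(1)}`), `untwistOver_some`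
  (`(x, y) ↦ (x/θ², y/θ³)`), **`map_untwistOver`** (functoriality along `f : L →ₐ[F] L'`, `θ ↦ f θ`),
  **`untwistOver_neg`** (`θ ↦ −θ` is `P ↦ −P` when `a₁(X) = a₃(X) = 0`);
* `twistPointEquiv W hC hd hθ : (W^{(d)})_L(L) ≃+ W_L(L)` (composition with the inverse of the rational substitution
  `C`), `map_twistPointEquiv`, `twistPointEquiv_neg`;
* the Galois corollaries, typed on the tree's `geomPoints` / `localPoints`: `twistGeomPointsEquiv`,
  `twistGeomPointsEquiv_smul_of_eq` / `…_of_eq_neg` (`e(σP) = ±σ e(P)` according as `σθ = ±θ`),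
  `twistLocalPointsEquiv` over an `F`-field `E` with `twistLocalPointsEquiv_smul_of_eq` / `…_of_eq_neg`, and the
  local square **`pointsMapOfEmb_twistGeomPointsEquiv`** (`ι_* ∘ e_θ = e_{ιθ} ∘ ι_*` for `ι : F̄ → Ē`).

Definitions with bodies and theorems only (no named fact, no instance, no `sorry`).

References: [SilvermanAEC2009] J. H. Silverman, *AEC*, 2nd ed., X.2 Prop. 2.4 (proof), X.5 Cor. 5.4, III.1 Table 3.1,
VIII.§1; [DokchitserDokchitserAnnals2010] T. & V. Dokchitser, Ann. of Math. 172 (2010), Lemma 4.14 («`E_α ≅ E` over `K(√α)`»).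
-/

noncomputable section

open scoped Classical

universe u

namespace WeierstrassCurve

open Literature.NumberTheory.EllipticCurves

/-! ## §1 The substitution `u = θ` over an extension `L ∋ θ`, `θ² = d` -/

section Sqrt

variable {F : Type u} [Field F] (W : WeierstrassCurve F) {d : F} (hd : d ≠ 0)
  {L : Type u} [Field L] [Algebra F L] {θ : L} (hθ : θ ^ 2 = algebraMap F L d)

include hd hθ in
/-- A square root of `d ≠ 0` is non-zero. [cite: SilvermanAEC2009, X.5 Cor. 5.4] -/
theorem sqrt_ne_zero_of_sq_eq : θ ≠ 0 := by
  intro h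
  rw [h, zero_pow two_ne_zero, eq_comm, map_eq_zero] at hθ
  exact hd hθ

/-- The change of variables `(u, r, s, t) = (θ, 0, 0, 0)` over `L`, `θ = √d` (Silverman, *AEC*, X.2, proof of
Prop. 2.4; X.5 Cor. 5.4 (iii)). [cite: SilvermanAEC2009, X.5 Cor. 5.4] -/
def sqrtChange : VariableChange L :=
  ⟨Units.mk0 θ (sqrt_ne_zero_of_sq_eq hd hθ), 0, 0, 0⟩

/-- The new `x`-coordinate under `sqrtChange`: `x' = x/θ²` (Silverman's Table 3.1 with `u = θ`, `r = s = t = 0`).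
[cite: SilvermanAEC2009, III.1 Table 3.1] -/
@[simp]
theorem toX_sqrtChange (x : L) : (sqrtChange hd hθ).toX x = (θ ^ 2)⁻¹ * x := by
  simp [VariableChange.toX_def, sqrtChange, Units.val_inv_eq_inv_val, inv_pow]

/-- The new `y`-coordinate under `sqrtChange`: `y' = y/θ³` (Silverman's Table 3.1 with `u = θ`, `r = s = t = 0`).
[cite: SilvermanAEC2009, III.1 Table 3.1] -/
@[simp]
theorem toY_sqrtChange (x y : L) : (sqrtChange hd hθ).toY x y = (θ ^ 3)⁻¹ * y := by
  simp [VariableChange.toY_def, sqrtChange, Units.val_inv_eq_inv_val, inv_pow]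

variable [NeZero (2 : F)]

/-- **`(θ,0,0,0) • (W^{(d)})_L = (W^{(1)})_L`**: over `L ∋ θ = √d` the substitution `u = θ` carries the twist by `d`
to the completed-square model (Silverman, *AEC*, X.5 Cor. 5.4 (iii): `E^{(d)} ≅ E` over `F(√d)`). The coefficient check
of the tree's `untwist_smul` (`IsogenyQuadraticTwistProofs`, `θ = geomSqrt d`) for an arbitrary square root in an
arbitrary extension. [cite: SilvermanAEC2009, X.5 Cor. 5.4] -/
theorem sqrtChange_smul :
    sqrtChange hd hθ • (W.quadraticTwist d).baseChange L = (W.quadraticTwist 1).baseChange L := by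
  have hθ0 : θ ≠ 0 := sqrt_ne_zero_of_sq_eq hd hθ
  have h2K : (2 : L) ≠ 0 := by
    rw [← map_ofNat (algebraMap F L) 2, map_ne_zero]
    exact two_ne_zero
  have h4 : (4 : L) ≠ 0 := by
    rw [show (4 : L) = 2 * 2 by norm_num]
    exact mul_ne_zero h2K h2K
  ext
  · simp [sqrtChange, baseChange, variableChange_a₁]
  · simp only [sqrtChange, baseChange, variableChange_a₂, map_a₁, map_a₂, quadraticTwist_a₁,
      quadraticTwist_a₂, map_zero, mul_zero, sub_zero, add_zero, one_mul,
      zero_pow two_ne_zero, map_div₀, map_mul, ← hθ, map_ofNat, inv_pow, Units.val_inv_eq_inv_val,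
      Units.val_mk0]
    field_simp
  · simp [sqrtChange, baseChange, variableChange_a₃]
  · simp only [sqrtChange, baseChange, variableChange_a₄, map_a₁, map_a₂, map_a₃, map_a₄,
      quadraticTwist_a₁, quadraticTwist_a₂, quadraticTwist_a₃, quadraticTwist_a₄, map_zero,
      mul_zero, sub_zero, add_zero, zero_mul, one_pow, one_mul, map_div₀, map_mul, map_pow, ← hθ,
      map_ofNat, inv_pow, Units.val_inv_eq_inv_val, Units.val_mk0, zero_pow two_ne_zero]
    field_simp
  · simp only [sqrtChange, baseChange, variableChange_a₆, map_a₁, map_a₂, map_a₃, map_a₄,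
      map_a₆, quadraticTwist_a₁, quadraticTwist_a₂, quadraticTwist_a₃, quadraticTwist_a₄,
      quadraticTwist_a₆, map_zero, mul_zero, sub_zero, add_zero, zero_mul, one_pow, one_mul,
      map_div₀, map_mul, map_pow, ← hθ, map_ofNat, inv_pow, Units.val_inv_eq_inv_val,
      Units.val_mk0, zero_pow two_ne_zero, zero_pow three_ne_zero]
    field_simp

omit [NeZero (2 : F)] in
/-- `−θ` defines the same equation as `θ`: `(−θ,0,0,0) • (W^{(d)})_L = (θ,0,0,0) • (W^{(d)})_L` (the twist model has
`a₁ = a₃ = 0`, and the even-weight coefficients see only `θ²`; Silverman's Table 3.1). [cite: SilvermanAEC2009, III.1 Table 3.1] -/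
theorem sqrtChange_neg_smul (hθ' : (-θ) ^ 2 = algebraMap F L d) :
    sqrtChange hd hθ' • (W.quadraticTwist d).baseChange L = sqrtChange hd hθ • (W.quadraticTwist d).baseChange L := by
  ext
  · simp [sqrtChange, baseChange, variableChange_a₁]
  · simp only [sqrtChange, baseChange, variableChange_a₂, map_a₁, map_a₂, quadraticTwist_a₁, map_zero, mul_zero,
      sub_zero, add_zero, inv_pow, Units.val_inv_eq_inv_val, Units.val_mk0, neg_sq]
  · simp [sqrtChange, baseChange, variableChange_a₃]
  · simp only [sqrtChange, baseChange, variableChange_a₄, map_a₁, map_a₃, quadraticTwist_a₁, quadraticTwist_a₃,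
      map_zero, mul_zero, sub_zero, zero_mul, inv_pow, Units.val_inv_eq_inv_val, Units.val_mk0,
      show (-θ) ^ 4 = θ ^ 4 from Even.neg_pow (by decide) θ]
  · simp only [sqrtChange, baseChange, variableChange_a₆, map_a₁, map_a₃, quadraticTwist_a₁, quadraticTwist_a₃,
      map_zero, mul_zero, sub_zero, zero_mul, inv_pow, Units.val_inv_eq_inv_val, Units.val_mk0,
      show (-θ) ^ 6 = θ ^ 6 from Even.neg_pow (by decide) θ]

end Sqrt

/-! ## §2 The point isomorphism `untwistOver` and its functoriality in `L` -/

section Untwist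

variable {F : Type u} [Field F] (W : WeierstrassCurve F) (X : WeierstrassCurve F) {d : F} (hd : d ≠ 0)
  {L : Type u} [Field L] [Algebra F L] {θ : L} (hθ : θ ^ 2 = algebraMap F L d)
  (hX : sqrtChange hd hθ • (W.quadraticTwist d).baseChange L = X.baseChange L)

/-- Two affine points with equal coordinates are equal (proof-irrelevance helper). [folklore] -/
private theorem some_eq_some_of_eq' {R : Type*} [Field R] {V : WeierstrassCurve.Affine R} {x y x' y' : R}
    (hx : x = x') (hy : y = y') {h : V.Nonsingular x y} {h' : V.Nonsingular x' y'} :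
    WeierstrassCurve.Affine.Point.some x y h = .some x' y' h' := by
  subst hx hy
  rfl

/-- **`untwistOver : (W^{(d)})_L(L) ≃+ X_L(L)`, `(x, y) ↦ (x/θ², y/θ³)`**, for any `X/F` with
`(θ,0,0,0) • (W^{(d)})_L = X_L` (`X = W^{(1)}` by `sqrtChange_smul`, or `X = C • W` for the completed square): the tree's
point isomorphism of the change of variables (`VariableChange.pointEquiv`) followed by the transport along the equality
(`Affine.Point.congrEquiv`). [cite: SilvermanAEC2009, X.5 Cor. 5.4] -/
def untwistOver : ((W.quadraticTwist d).baseChange L).toAffine.Point ≃+ (X.baseChange L).toAffine.Point :=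
  (VariableChange.pointEquiv ((W.quadraticTwist d).baseChange L) (sqrtChange hd hθ)).trans
    (Affine.Point.congrEquiv hX)

/-- `untwistOver` on an affine point: `(x, y) ↦ (x/θ², y/θ³)`. [cite: SilvermanAEC2009, III.1 Table 3.1] -/
theorem untwistOver_some {x y : L} (h : ((W.quadraticTwist d).baseChange L).toAffine.Nonsingular x y) :
    ∃ h', untwistOver W X hd hθ hX (.some x y h) =
      (.some ((θ ^ 2)⁻¹ * x) ((θ ^ 3)⁻¹ * y) h' : (X.baseChange L).toAffine.Point) := by
  have h' : (X.baseChange L).toAffine.Nonsingular ((θ ^ 2)⁻¹ * x) ((θ ^ 3)⁻¹ * y) := by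
    rw [← toX_sqrtChange hd hθ, ← toY_sqrtChange hd hθ x y, ← hX, VariableChange.nonsingular_iff]
    exact h
  refine ⟨h', ?_⟩
  change Affine.Point.congrEquiv hX (VariableChange.pointEquiv _ _ (.some x y h)) = _
  rw [VariableChange.pointEquiv_some, Affine.Point.congrEquiv_some]
  exact some_eq_some_of_eq' (toX_sqrtChange hd hθ x) (toY_sqrtChange hd hθ x y)

variable {L' : Type u} [Field L'] [Algebra F L'] {θ' : L'} (hθ' : θ' ^ 2 = algebraMap F L' d)
  (hX' : sqrtChange hd hθ' • (W.quadraticTwist d).baseChange L' = X.baseChange L')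

/-- **Functoriality of `untwistOver` in the coefficient field**: for an `F`-algebra homomorphism `f : L → L'` with
`f θ = θ'`, the substitutions over `L` and `L'` commute with the maps on points induced by `f` (both are given by the
same formula `(x, y) ↦ (x/θ², y/θ³)`). [cite: SilvermanAEC2009, III.1 Table 3.1 and VIII.§1] -/
theorem map_untwistOver (f : L →ₐ[F] L') (hf : f θ = θ') (P : ((W.quadraticTwist d).baseChange L).toAffine.Point) :
    Affine.Point.map f (untwistOver W X hd hθ hX P) = untwistOver W X hd hθ' hX' (Affine.Point.map f P) := by
  rcases P with _ | ⟨x, y, h⟩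
  · simp only [← Affine.Point.zero_def, map_zero]
  · obtain ⟨h₁, e₁⟩ := untwistOver_some W X hd hθ hX h
    rw [e₁, Affine.Point.map_some, Affine.Point.map_some]
    obtain ⟨h₂, e₂⟩ := untwistOver_some W X hd hθ' hX'
      ((WeierstrassCurve.Affine.baseChange_nonsingular (W := (W.quadraticTwist d).toAffine) f.injective ..).mpr h)
    rw [e₂]
    exact some_eq_some_of_eq' (by rw [map_mul, map_inv₀, map_pow, hf]) (by rw [map_mul, map_inv₀, map_pow, hf])

variable {hθ'} {hX'} in
/-- **The sign rule**: replacing `θ` by `−θ` replaces `untwistOver` by its negative, `(x/θ², −y/θ³) = −(x/θ², y/θ³)`,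
when `a₁(X) = a₃(X) = 0` (so that `−(x, y) = (x, −y)` on `X`). Silverman, *AEC*, X.2, proof of Prop. 2.4.
[cite: SilvermanAEC2009, X.2 Prop. 2.4] -/
theorem untwistOver_neg (hX1 : X.a₁ = 0) (hX3 : X.a₃ = 0) (hθn : (-θ) ^ 2 = algebraMap F L d)
    (hXn : sqrtChange hd hθn • (W.quadraticTwist d).baseChange L = X.baseChange L)
    (P : ((W.quadraticTwist d).baseChange L).toAffine.Point) :
    untwistOver W X hd hθn hXn P = -untwistOver W X hd hθ hX P := by
  rcases P with _ | ⟨x, y, h⟩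
  · simp only [← Affine.Point.zero_def, map_zero, neg_zero]
  · obtain ⟨h₁, e₁⟩ := untwistOver_some W X hd hθn hXn h
    obtain ⟨h₂, e₂⟩ := untwistOver_some W X hd hθ hX h
    rw [e₁, e₂, Affine.Point.neg_some]
    refine some_eq_some_of_eq' (by rw [neg_sq]) ?_
    simp only [Affine.negY, baseChange, map_a₁, map_a₃, hX1, hX3, map_zero, zero_mul, sub_zero,
      Odd.neg_pow (by decide : Odd 3), inv_neg, neg_mul]

end Untwist

/-! ## §3 The full twist isomorphism `twistPointEquiv : (W^{(d)})_L(L) ≃+ W_L(L)` -/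

section Twist

variable {F : Type u} [Field F] [NeZero (2 : F)] (W : WeierstrassCurve F) {C : VariableChange F}
  (hC : C • W = W.quadraticTwist 1) {d : F} (hd : d ≠ 0)
  {L : Type u} [Field L] [Algebra F L] {θ : L} (hθ : θ ^ 2 = algebraMap F L d)

include hC in
/-- With `C • W = W^{(1)}`: `(θ,0,0,0) • (W^{(d)})_L = (C • W)_L`. [cite: SilvermanAEC2009, X.5 Cor. 5.4] -/
theorem sqrtChange_smul_eq_smul_baseChange :
    sqrtChange hd hθ • (W.quadraticTwist d).baseChange L = (C • W).baseChange L := by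
  rw [sqrtChange_smul W hd hθ, hC]

/-- **The twist isomorphism `E^{(d)}(L) ≃+ E(L)` over `L ∋ θ = √d`**: `untwistOver` onto `(C • W)_L` followed by the
inverse of the rational substitution `C` (`VariableChange.pointEquivBaseChange`). Silverman, *AEC*, X.5 Cor. 5.4 (iii);
T. & V. Dokchitser, Lemma 4.14 («`E_α ≅ E` over `K(√α)`»). [cite: SilvermanAEC2009, X.5 Cor. 5.4]
[cite: DokchitserDokchitserAnnals2010, Lemma 4.14] -/
def twistPointEquiv : ((W.quadraticTwist d).baseChange L).toAffine.Point ≃+ (W.baseChange L).toAffine.Point :=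
  (untwistOver W (C • W) hd hθ (sqrtChange_smul_eq_smul_baseChange W hC hd hθ)).trans
    (VariableChange.pointEquivBaseChange W C L).symm

/-- Unfolding `twistPointEquiv` (composition of the substitution `u = θ` with the inverse rational substitution).
[cite: SilvermanAEC2009, X.5 Cor. 5.4] -/
theorem twistPointEquiv_apply (P : ((W.quadraticTwist d).baseChange L).toAffine.Point) :
    twistPointEquiv W hC hd hθ P = (VariableChange.pointEquivBaseChange W C L).symm
      (untwistOver W (C • W) hd hθ (sqrtChange_smul_eq_smul_baseChange W hC hd hθ) P) :=
  rfl

variable {L' : Type u} [Field L'] [Algebra F L'] {θ' : L'} (hθ' : θ' ^ 2 = algebraMap F L' d)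

/-- **Functoriality of the twist isomorphism in the coefficient field**: for `f : L →ₐ[F] L'` with `f θ = θ'`,
`f_* ∘ e_θ = e_{θ'} ∘ f_*` (`map_untwistOver` and `VariableChange.pointEquivBaseChange_symm_map`: the rational
substitution `C` commutes with `f`). [cite: SilvermanAEC2009, III.1 Table 3.1 and VIII.§1] -/
theorem map_twistPointEquiv (f : L →ₐ[F] L') (hf : f θ = θ')
    (P : ((W.quadraticTwist d).baseChange L).toAffine.Point) :
    Affine.Point.map f (twistPointEquiv W hC hd hθ P) = twistPointEquiv W hC hd hθ' (Affine.Point.map f P) := by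
  rw [twistPointEquiv_apply, twistPointEquiv_apply, VariableChange.pointEquivBaseChange_symm_map,
    map_untwistOver W (C • W) hd hθ _ hθ' _ f hf]

/-- **The sign rule for the twist isomorphism**: `e_{−θ} = −e_θ`. [cite: SilvermanAEC2009, X.2 Prop. 2.4] -/
theorem twistPointEquiv_neg (hθn : (-θ) ^ 2 = algebraMap F L d)
    (P : ((W.quadraticTwist d).baseChange L).toAffine.Point) :
    twistPointEquiv W hC hd hθn P = -twistPointEquiv W hC hd hθ P := by
  have h1 : (C • W).a₁ = 0 := by rw [hC]; rfl
  have h3 : (C • W).a₃ = 0 := by rw [hC]; rfl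
  rw [twistPointEquiv_apply, twistPointEquiv_apply, ← map_neg,
    untwistOver_neg W (C • W) hd hθ (sqrtChange_smul_eq_smul_baseChange W hC hd hθ) h1 h3 hθn]

/-! ### Galois corollaries: geometric points, local points, and the local square -/

/-- The twist isomorphism on GEOMETRIC points, `E^{(d)}(F̄) ≃+ E(F̄)` (`twistPointEquiv` over `L = F̄` at a square root
`θ ∈ F̄` of `d`, typed on the tree's `geomPoints`). [cite: SilvermanAEC2009, X.5 Cor. 5.4] -/
def twistGeomPointsEquiv {θ : AlgebraicClosure F} (hθ : θ ^ 2 = algebraMap F (AlgebraicClosure F) d) :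
    (W.quadraticTwist d).geomPoints ≃+ W.geomPoints :=
  twistPointEquiv W hC hd hθ

/-- The twist isomorphism on LOCAL points over an `F`-field `E`, `E^{(d)}(Ē) ≃+ E(Ē)` (`twistPointEquiv` over `L = Ē`
at a square root `θ ∈ Ē` of `d`, typed on the tree's `localPoints`). [cite: SilvermanAEC2009, X.5 Cor. 5.4] -/
def twistLocalPointsEquiv (E : Type u) [Field E] [Algebra F E] {θ : AlgebraicClosure E}
    (hθ : θ ^ 2 = algebraMap F (AlgebraicClosure E) d) :
    localPoints (W.quadraticTwist d) E ≃+ localPoints W E :=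
  twistPointEquiv W hC hd hθ

/-- **`e_θ(σP) = σ e_θ(P)` when `σθ = θ`** (`σ ∈ Γ_F`, geometric points). [cite: SilvermanAEC2009, X.5 Cor. 5.4] -/
theorem twistGeomPointsEquiv_smul_of_eq {θ : AlgebraicClosure F} (hθ : θ ^ 2 = algebraMap F (AlgebraicClosure F) d)
    (σ : Field.absoluteGaloisGroup F) (hσ : σ • θ = θ) (P : (W.quadraticTwist d).geomPoints) :
    twistGeomPointsEquiv W hC hd hθ (σ • P) = σ • twistGeomPointsEquiv W hC hd hθ P := by
  change twistPointEquiv W hC hd hθ (Affine.Point.map _ P) = Affine.Point.map _ (twistPointEquiv W hC hd hθ P)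
  rw [map_twistPointEquiv W hC hd hθ hθ _ hσ]

/-- **`e_θ(σP) = −σ e_θ(P)` when `σθ = −θ`**: the Galois module `E^{(d)}(F̄)` is `E(F̄)` twisted by the quadratic
character of `F(√d)/F` (Silverman, *AEC*, X.2 Prop. 2.4). [cite: SilvermanAEC2009, X.2 Prop. 2.4] -/
theorem twistGeomPointsEquiv_smul_of_eq_neg {θ : AlgebraicClosure F}
    (hθ : θ ^ 2 = algebraMap F (AlgebraicClosure F) d) (σ : Field.absoluteGaloisGroup F) (hσ : σ • θ = -θ)
    (P : (W.quadraticTwist d).geomPoints) :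
    twistGeomPointsEquiv W hC hd hθ (σ • P) = -(σ • twistGeomPointsEquiv W hC hd hθ P) := by
  have hθn : (-θ) ^ 2 = algebraMap F (AlgebraicClosure F) d := by rw [neg_sq, hθ]
  change twistPointEquiv W hC hd hθ (Affine.Point.map _ P) = -Affine.Point.map _ (twistPointEquiv W hC hd hθ P)
  rw [map_twistPointEquiv W hC hd hθ hθn _ hσ, twistPointEquiv_neg W hC hd hθ hθn, neg_neg]

variable {E : Type u} [Field E] [Algebra F E]

/-- **Local points, `τθ = θ`**: for an `F`-field `E`, `τ ∈ Γ_E` and `θ = √d ∈ Ē` fixed by `τ`, `e_θ(τQ) = τ e_θ(Q)` on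
`E^{(d)}(Ē)` (the action is through `τ.restrictScalars F`, `localPoints.smul_def`). [cite: SilvermanAEC2009, X.5 Cor. 5.4] -/
theorem twistLocalPointsEquiv_smul_of_eq {θ : AlgebraicClosure E}
    (hθ : θ ^ 2 = algebraMap F (AlgebraicClosure E) d) (τ : Field.absoluteGaloisGroup E) (hτ : τ • θ = θ)
    (Q : localPoints (W.quadraticTwist d) E) :
    twistLocalPointsEquiv W hC hd E hθ (τ • Q) = τ • twistLocalPointsEquiv W hC hd E hθ Q := by
  rw [localPoints.smul_def, localPoints.smul_def]
  exact (map_twistPointEquiv W hC hd hθ hθ _ hτ Q).symm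

/-- **Local points, `τθ = −θ`**: `e_θ(τQ) = −τ e_θ(Q)`. [cite: SilvermanAEC2009, X.2 Prop. 2.4] -/
theorem twistLocalPointsEquiv_smul_of_eq_neg {θ : AlgebraicClosure E}
    (hθ : θ ^ 2 = algebraMap F (AlgebraicClosure E) d) (τ : Field.absoluteGaloisGroup E) (hτ : τ • θ = -θ)
    (Q : localPoints (W.quadraticTwist d) E) :
    twistLocalPointsEquiv W hC hd E hθ (τ • Q) = -(τ • twistLocalPointsEquiv W hC hd E hθ Q) := by
  have hθn : (-θ) ^ 2 = algebraMap F (AlgebraicClosure E) d := by rw [neg_sq, hθ]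
  rw [localPoints.smul_def, localPoints.smul_def]
  change twistPointEquiv W hC hd hθ (Affine.Point.map _ Q) = -Affine.Point.map _ (twistPointEquiv W hC hd hθ Q)
  rw [map_twistPointEquiv W hC hd hθ hθn _ hτ, twistPointEquiv_neg W hC hd hθ hθn, neg_neg]

/-- **The local square**: for an `F`-embedding `ι : F̄ → Ē` the twist isomorphisms over `F̄` (at `θ`) and over `Ē`
(at `ι θ`) commute with the maps on points `pointsMapOfEmb ι : E(F̄) → E(Ē)` — the compatibility needed to compare the
local Selmer conditions of `E^{(d)}` and `E`. [cite: SilvermanAEC2009, VIII.§1 and X.§4] -/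
theorem pointsMapOfEmb_twistGeomPointsEquiv {θ : AlgebraicClosure F}
    (hθ : θ ^ 2 = algebraMap F (AlgebraicClosure F) d) (ι : AlgebraicClosure F →ₐ[F] AlgebraicClosure E)
    {θE : AlgebraicClosure E} (hθE : θE ^ 2 = algebraMap F (AlgebraicClosure E) d) (hι : ι θ = θE)
    (P : (W.quadraticTwist d).geomPoints) :
    pointsMapOfEmb W ι (twistGeomPointsEquiv W hC hd hθ P) =
      twistLocalPointsEquiv W hC hd E hθE (pointsMapOfEmb (W.quadraticTwist d) ι P) :=
  map_twistPointEquiv W hC hd hθ hθE ι hι P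

end Twist

end WeierstrassCurve

end
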